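import Summits.QuantumFields.YangMills.Theorems.BalabanUVNodesN12AtRecord12TermPin
import Literature.MathematicalPhysics.QuantumFieldTheory.Balaban1983to89.B15Claim189ZppPin

/-!
# BalabanUVNodes ∕ N12 AT THE `Z″`-PINNED TERM LAYER `λᶻ := (λ.pinRPrime θ₉).pinD189Z θ₉ σ s enl p₁` — the [IV] leaf with the (1.89) display replaced by its printed inputs,
# print's `N₀` and `Z″_j` objects of the term, and p. 200's «We have j = k» no longer a hypothesis
# (sequel of `BalabanUVNodesN12AtRecord12TermPin` (v1.2: λ⁵, λᴺ leaves) — the ≤ 400-line rule for Theorems files puts the λᶻ leaf in this separate file; Track A, DAG node N12 =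
# [B15, Balaban1989LargeFieldI] CMP 122 (1989) 175; cluster K1′ `StabilityBAtRecordR12e` = stmt-QuantumFields-19903 (rev 15); seat `pub-ymgap-dag-n12-e` g4, 2026-08-27; count-neutral, NOT a discharge)
HONEST FRAMING.  Count-neutral kernel BOOKKEEPING BY NAME over dag-n12-d's module 1 (`…Pointed` §3) and this seat's Literature modules 11–13; nothing of Bałaban's asserted; N12 NOT discharged
(5∕27 unchanged); nothing continuum ∕ ℝ⁴ ∕ OS ∕ mass gap ∕ Clay.
WHY THIS FILE.  Module 13 (`B15Claim189ZppPin`) pins the new large-field regions `Z″_j` of the (1.89) situation to the term's (2.1)-chain per [IV] (1.10)–(1.11) (p. 179) — `Z″_j = Λ_jᶜ ∩ Z`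
(`j ≤ h`), `(Ω_j^{∼5})ᶜ ∩ Z` (`h < j ≤ k₀`), `(Ω_{k₀+1}^{∼7})ᶜ ∩ Z`, `Z″_k = (Ω_{k₀+1}^{∼5})ᶜ ∩ Z` (the interpolated levels and the enlargement `∼n` stay letters) — and proves p. 200's
*"We have j = k"* (`hZk`): `Z″_k ∩ Ω_m = ∅` for `m ≥ k₀ + 1`.  Here that is knitted into dag-n12-d's [IV] leaf: at `λᶻ` the leaf needs NO (1.89) display, NO `N₀` parameter, NO
«We have j = k» hypothesis.
* `WOfRecord₁₀_pinAllZ` (`rfl`), **`b15Leaf_WOfRecord₁₀_pinAllZ_of_deg_massSel`** (window form; displayed: `Provisos₁₀`, `hdeg`, `hmassSel ∧ hfib`, Prop. 1, (1.80), `r ≥ 1`, `N₀(P) ≤ Nmem`,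
  `N₀(P) ≤ kSel P + 1`, `β, L₀`, signs, the top-coupling threshold, `β ≥ 0` along the history, print's second condition, the run's (2.7)-small window + BOX β bound, the shell bound,
  the (1.88) cover, the four ℍ-leaves, and `henl : S ⊆ enl P n j S`).
Sources: [Balaban1989LargeFieldI] (0.2)–(0.6) p.176, (1.10)–(1.11) p.179, Prop. 1 p.194, (1.80) p.195, (1.89) p.198, pp.199–200; [Balaban1988Convergent] (2.1) p.254, (2.5)–(2.8) pp.255–256.
-/

noncomputable section

open MeasureTheory

namespace Summit.QuantumFields.YangMills.BalabanUVNodes.N12AtRecord12TermPinZ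
open Literature.MathematicalPhysics.QuantumFieldTheory.Balaban1983to89
open Literature.MathematicalPhysics.QuantumFieldTheory.Balaban1983to89.T4Continuum (T4Family)
open Literature.MathematicalPhysics.QuantumFieldTheory.Balaban1983to89.DagBinding (B15Leaf)
open Literature.MathematicalPhysics.QuantumFieldTheory.Balaban1983to89.Node00
open B15Claim189Assembly (Setting189 new189 chiPP dom half)
open B15Claim189PrintedConditions (omegaOfChain)
open B15Claim189N0OfRecord (N0OfRecord)
open B15Claim189ZppPin (h189_pinD189Z_of_h180)
open B15DeterminingSets (MSField)
open B15 (Prop1Printed Ineq180)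
open B15.PrelimIntegrations (Ineq191 Ineq195)
open B15Chi124DetSets (E124)
open B14DomainGeom (Pt)
open B8Eq17ClassAkV1 (plaqsOf)
open GaugeGroup (dist1)
open GaugeField (plaqHol)
open FlowStep (prefixOf BetaUpperH)
open B14FlowStep (SmallnessFor)
open Summit.QuantumFields.YangMills.BalabanUVNodes.N12AtRecord12Pointed (b15Leaf_WOfRecord₁₀_pinAllχ₀_of_deg_massSel)

variable {N : ℕ} [NeZero N] {F : T4Family}

/-! ## PRINT'S `Z″_j` — the layer `λᶻ := (λ.pinRPrime θ₉).pinD189Z θ₉ σ s enl p₁` (module 13: `Z″_j` from the term's chain per (1.10)–(1.11), `N₀` of record;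
p. 200's *"We have j = k"* no longer a hypothesis) -/

section Zpp
variable {θ : Stage9Params F N} {lam : ResidW F N} (σ : ∀ P : B12.RunParams, Sit189 F N P.K)
  (s : ∀ P : B12.RunParams, SeqOfRecord F θ.ν θ.τ9.M (gOfRecord₁₀ F N θ P) P.K (lam.kSel P + 1))
  (enl : ∀ P : B12.RunParams, ℕ → ℕ → Set (Site (F.P P.K) 0) → Set (Site (F.P P.K) 0)) (p₁ : ℕ)

/-- At run `P` the `Z″`-pinned layer's [IV] bundle of record IS the term-pinned one at the `Z″`-pinned situation and `N₀ := N0OfRecord θ P (kSel P + 1)` (`rfl`).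
[cite: Balaban1989LargeFieldI, (0.2) p.176, (1.89) p.198, (1.10)–(1.11) p.179 (bookkeeping)] -/
theorem WOfRecord₁₀_pinAllZ (P : B12.RunParams) : WOfRecord₁₀ F N θ ((lam.pinRPrime θ).pinD189Z θ σ s enl p₁) P =
    WOfRecord₁₀ F N θ ((lam.pinRPrime θ).pinD189T θ (fun P => (σ P).pinZpp (s P) (N0OfRecord θ P (lam.kSel P + 1)) θ.τ9.Nmem (enl P)) s
      (N0OfRecord θ P (lam.kSel P + 1)) p₁) P := rfl

/-- **THE [IV] LEAF AT `WOfRecord₁₀ θ λᶻ P` — NO (1.89) DISPLAY, NO `N₀` PARAMETER, NO «We have j = k» HYPOTHESIS** (`…TermPin` §1's leaf `b15Leaf_WOfRecord₁₀_pinAllχ₀_of_deg_massSel`-route at the `Z″`-pinned situations; module 13's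
`h189_pinD189Z_of_h180`; the enlargement letter inflationary, `henl`).  Letters via `hD : D = λᶻ.D189 P` (`rfl`). [cite: Balaban1989LargeFieldI, (0.2)–(0.6) p.176, Prop. 1 (1.78) p.194, (1.80) p.195, (1.89) p.198, pp.199–200, (1.10)–(1.11) p.179; Balaban1988Convergent, (2.1) p.254, (2.5)–(2.8) pp.255–256] -/
theorem b15Leaf_WOfRecord₁₀_pinAllZ_of_deg_massSel (hP : θ.Provisos₁₀) {P : B12.RunParams} (henl : ∀ n j (S : Set (Site (F.P P.K) 0)), S ⊆ enl P n j S)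
    {D : Setting189 (F.P P.K) (SU N) (MSField (F.P P.K) (SU N) × ((j : ℕ) → VecField (F.P P.K) j (EuclideanSpace ℝ (Fin (N ^ 2 - 1))))) (Pt (F.P P.K).d)}
    (hD : D = ((lam.pinRPrime θ).pinD189Z θ σ s enl p₁).D189 P)
    (hdeg : P.K ≤ lam.kSel P →
      (repDataOfSel (repTOfRecord9 F N θ.ν θ.τ9 (EOfRecord₁₀ F N θ) (wOfRecord₉ F N θ) θ.ppSel P (gOfRecord₁₀ F N θ P) (lam.kSel P))
        (θ.ppSel P (gOfRecord₁₀ F N θ P) (lam.kSel P + 1)) (fibOfSeq F θ.ν θ.τ9 P (gOfRecord₁₀ F N θ P) (lam.kSel P + 1))).ProvisosSupp)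
    (hmassSel : ∀ t, 0 < ∫ V, rterm (repTOfRecord9 F N θ.ν θ.τ9 (EOfRecord₁₀ F N θ) (wOfRecord₉ F N θ) θ.ppSel P (gOfRecord₁₀ F N θ P) (lam.kSel P))
      (θ.ppSel P (gOfRecord₁₀ F N θ P) (lam.kSel P + 1) t) V ∂(fieldMeasure (F.P P.K) (lam.kSel P + 1) (SU N)))
    (hfib : ∀ t, ∃ t', θ.ppSel P (gOfRecord₁₀ F N θ P) (lam.kSel P + 1) t' = θ.ppSel P (gOfRecord₁₀ F N θ P) (lam.kSel P + 1) t ∧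
      0 < ∫ V, rterm (repTOfRecord9 F N θ.ν θ.τ9 (EOfRecord₁₀ F N θ) (wOfRecord₉ F N θ) θ.ppSel P (gOfRecord₁₀ F N θ P) (lam.kSel P)) t' V
        ∂(fieldMeasure (F.P P.K) (lam.kSel P + 1) (SU N)))
    (hP1 : Prop1Printed (lam.LF P))
    (h180 : ∀ U, new189 D U → ∀ i, D.h ≤ i → i ≤ D.k → ∀ q ∈ plaqsOf (dom D i), Ineq180 (D.dev0 U q) (D.ε D.k) D.η D.B₃ D.B₅ D.M D.δ (D.dist q) D.O1)
    (hr : 1 ≤ θ.ν.r) (hNN : N0OfRecord θ P (lam.kSel P + 1) ≤ θ.τ9.Nmem) (hNk : N0OfRecord θ P (lam.kSel P + 1) ≤ lam.kSel P + 1)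
    (hβ0 : 0 ≤ (σ P).β) (hβ : (σ P).β ≤ 1 / 4) (hL₀ : 2 ≤ (σ P).L₀) (hL₀L : (σ P).L₀ ^ 2 ≤ ((F.P P.K).L : ℝ))
    (hB : 0 ≤ (σ P).O1 * (σ P).B₃ * (σ P).B₅) (hδ : 0 ≤ (σ P).δ) (hdist : ∀ p, 0 ≤ (σ P).dist p)
    (hwin : 4 * (2 + (121 / 120) ^ 2 * ((σ P).O1 * (σ P).B₃ * (σ P).B₅ * (θ.τ9.M : ℝ) ^ 5))
      ≤ ((Real.log (gOfRecord₁₀ F N θ P (lam.kSel P + 1) ^ 2)⁻¹) ^ θ.ν.r) ^ (Real.log ((σ P).L₀ ^ 2) / Real.log ((F.P P.K).L : ℝ)))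
    (hβhist : ∀ j, j < lam.kSel P + 1 → 0 ≤ betaOfRecord₁₀ F N θ j (prefixOf (gOfRecord₁₀ F N θ P) j))
    (hMl : (121 / 120) ^ 2 * ((σ P).O1 * (σ P).B₃ * (σ P).B₅ * (θ.τ9.M : ℝ) ^ 5) * Real.exp (-(4 * (σ P).δ * (θ.τ9.M : ℝ))) ≤ 1 / 12)
    (hA₀ : 0 ≤ θ.ν.A₀) {β' β₀ : ℝ} {L : ℕ} (S : SmallnessFor θ.γ β' β₀ L θ.ν.p₀) (hβ₀ : β₀ ≤ 1 / 2) (hε10 : θ.γ * p0Profile θ.ν.A₀ θ.ν.p₀ θ.γ ≤ 1 / 10)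
    (hI : Step.InInterval θ.γ (lam.kSel P + 1) (gOfRecord₁₀ F N θ P)) (hup : BetaUpperH β' θ.γ (betaOfRecord₁₀ F N θ))
    (hgeom : ∀ m, D.k₀ < m → m < D.k → ∀ p ∈ plaqsOf (D.Ω m \ D.Ω (m + 1)), 4 * ((m : ℝ) - D.k₀) * D.M ≤ D.dist p)
    (hbox : ∀ p ∈ plaqsOf (half D), D.boxOf p ∈ D.halfcubes ∧ p ∈ D.plaqT (D.boxOf p))
    (L91h : ∀ U, new189 D U → ∀ p ∈ plaqsOf (half D),
      Ineq191 (dist1 (plaqHol (D.Upp U) p)) (D.devV'' U p) D.α ((D.L ^ D.h)⁻¹) (D.ε D.h) (E124 D.ε D.L D.η D.k D.h))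
    (L95 : ∀ U, new189 D U → ∀ p ∈ plaqsOf (half D),
      Ineq195 (D.devV'' U p) (dist1 (plaqHol (D.Uhalf U (D.boxOf p)) p)) D.α ((D.L ^ D.h)⁻¹) (D.ε D.h) (E124 D.ε D.L D.η D.k D.h))
    (L91 : ∀ U, new189 D U → ∀ j, D.h ≤ j → j ≤ D.k → ∀ p ∈ plaqsOf (dom D j),
      Ineq191 (dist1 (plaqHol (D.Upp U) p)) (D.dev97 U p) D.α ((D.L ^ j)⁻¹) (D.ε j) (E124 D.ε D.L D.η D.k j))
    (L97 : ∀ U, new189 D U → ∀ j, D.h ≤ j → j ≤ D.k → ∀ p ∈ plaqsOf (dom D j),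
      Ineq191 (D.dev97 U p) (D.dev0 U p) D.α ((D.L ^ j)⁻¹) (D.ε j) (E124 D.ε D.L D.η D.k j)) :
    B15Leaf (WOfRecord₁₀ F N θ ((lam.pinRPrime θ).pinD189Z θ σ s enl p₁) P) := by
  subst hD
  exact b15Leaf_WOfRecord₁₀_pinAllχ₀_of_deg_massSel
    (fun P => (((σ P).pinZpp (s P) (N0OfRecord θ P (lam.kSel P + 1)) θ.τ9.Nmem (enl P)).pinTerm (s P)).pinNumerics θ.τ9 (N0OfRecord θ P (lam.kSel P + 1))) p₁
    hP hdeg hmassSel hfib hP1 h180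
    (h189_pinD189Z_of_h180 (lam.pinRPrime θ) σ s enl p₁ P henl rfl hr hNN hNk hβ0 hβ hL₀ hL₀L hB hδ hdist hwin hβhist hMl hA₀ S hβ₀ hε10 hI hup hgeom hbox
      L91h L95 L91 L97 h180)

end Zpp

end Summit.QuantumFields.YangMills.BalabanUVNodes.N12AtRecord12TermPinZ

end
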